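import Mathlib.Analysis.InnerProductSpace.Dual
import Mathlib.Analysis.Normed.Module.HahnBanach
import Mathlib.LinearAlgebra.Isomorphisms
import HarnessLib

/-!
# Lions' projection theorem over `ℝ` or `ℂ`, keyed on the Riesz representers of the test functionals

`Literature/Analysis/OperatorTheory`; proofs-layer file (theorems only; no definitions, no named facts).  The real-scalar
statement with an abstract bilinear form is the tree's `Literature.Analysis.OperatorTheory.exists_eq_of_coercive`
(`LionsProjection.lean`).  Here: scalars `𝕜` with `[RCLike 𝕜]` (so complex spectral parameters are allowed), and the form
is entered through the REPRESENTERS of the test functionals — a linear map `K : Φ → F` with "`E(u, φ) = ⟪u, K φ⟫`" — which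
is how a differential operator `𝒜` acts on test functions through its formal adjoint (`K φ = 𝒜†φ`), with NO boundedness of
`𝒜` on `F` assumed: continuity of `u ↦ E(u, φ)` for each FIXED `φ` is automatic, and that is all Lions' theorem asks.

**Theorem** (`exists_inner_eq_of_coercive`) [cite: LionsMagenes1972, Chap. 3 Thm. 1.1 and Remark 1.3 (Lions' theorem)].
Let `F` be a Hilbert space over `𝕜`, `Φ` a `𝕜`-vector space with linear maps `j, K : Φ → F` and a function `q ≥ 0` on `Φ`
with `‖j φ‖ ≤ C q(φ)` (`C ≥ 0`); assume COERCIVITY ON THE TEST SPACE `α q(φ)² ≤ ‖⟪j φ, K φ⟫‖` (`α > 0`; e.g. from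
`α q(φ)² ≤ Re⟪j φ, K φ⟫`, `exists_inner_eq_of_re_coercive`).  Then every linear `L : Φ → 𝕜` with `‖L φ‖ ≤ C_L q(φ)`
(`C_L ≥ 0`) is represented: there is `u ∈ F` with `⟪u, K φ⟫ = L(φ)` for all `φ ∈ Φ`, and moreover `‖u‖ ≤ C_L (C/α)`.
Proof (Lions): coercivity gives `q(φ) ≤ (C/α)‖K φ‖` (`le_norm_repr_of_coercive`), so `ker K ≤ ker L` and `L` descends to a
functional on `range K` bounded by `C_L C/α` in the norm of `F` (first isomorphism theorem `LinearMap.quotKerEquivRange` +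
`Submodule.liftQ`); extend it to `F` with the same norm (Hahn–Banach, `exists_extension_norm_eq`; `𝕜` is `RCLike`) and
represent it (Riesz, `InnerProductSpace.toDual`).  Uniqueness is NOT asserted (and fails in general).

Typical instance (recorded for provenance; nothing below depends on it): `F =` an energy Hilbert space `E` (or the pivot
`L²_w`), `Φ =` smooth compactly supported / frame test functions, `j =` the inclusion, `q = ‖·‖_E`, `K φ = 𝒜(σ)†φ` for a
linearisation `𝒜(σ) = 𝒜 + σ` whose quadratic form is coercive on `Φ` in the `E`-norm although `𝒜` is NOT a bounded
operator on `E` (cell ns-blowup, Z3-SR-SPEC MODEL-ASSEMBLY item (β): existence of a weak solution `u ∈ E` of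
`(A_F + σ)u = g`, `⟪u, (A_F + σ)†φ⟫_w = ⟪g, φ⟫_w` for all test `φ`, with `‖u‖_E ≤ ‖g‖_w · C/α`).  WHAT THIS IS NOT: nothing
about Navier–Stokes; abstract functional analysis.

## References
* [LionsMagenes1972] J.-L. Lions, E. Magenes, *Non-Homogeneous Boundary Value Problems and Applications* I, Springer
  1972, Chap. 3, Thm. 1.1 and Remark 1.3 (Lions' theorem); J.-L. Lions, *Équations différentielles opérationnelles*,
  Springer 1961, Chap. III Thm. 1.1.
-/

noncomputable section

open scoped InnerProductSpace

namespace Literature.Analysis.OperatorTheory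

variable {𝕜 : Type*} [RCLike 𝕜]
variable {F : Type*} [NormedAddCommGroup F] [InnerProductSpace 𝕜 F]
variable {Φ : Type*} [AddCommGroup Φ] [Module 𝕜 Φ]

/-- The a-priori estimate behind Lions' theorem: `α q(φ)² ≤ ‖⟪j φ, K φ⟫‖`, `‖j φ‖ ≤ C q(φ)`, `C ≥ 0`, `q ≥ 0` give
`q(φ) ≤ (C/α) ‖K φ‖`. [cite: LionsMagenes1972, Chap. 3 Thm. 1.1 (proof)] -/
theorem le_norm_repr_of_coercive (j : Φ →ₗ[𝕜] F) (q : Φ → ℝ) (hq : ∀ φ, 0 ≤ q φ) {C : ℝ} (hC : 0 ≤ C)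
    (hj : ∀ φ, ‖j φ‖ ≤ C * q φ) (K : Φ →ₗ[𝕜] F) {α : ℝ} (hα : 0 < α)
    (hcoer : ∀ φ, α * q φ ^ 2 ≤ ‖⟪j φ, K φ⟫_𝕜‖) (φ : Φ) : q φ ≤ C / α * ‖K φ‖ := by
  have h1 : α * q φ ^ 2 ≤ ‖K φ‖ * (C * q φ) := by
    calc α * q φ ^ 2 ≤ ‖⟪j φ, K φ⟫_𝕜‖ := hcoer φ
      _ ≤ ‖j φ‖ * ‖K φ‖ := norm_inner_le_norm _ _
      _ ≤ (C * q φ) * ‖K φ‖ := mul_le_mul_of_nonneg_right (hj φ) (norm_nonneg _)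
      _ = ‖K φ‖ * (C * q φ) := by ring
  rcases (hq φ).eq_or_lt with h0 | hpos
  · rw [← h0]; positivity
  · have h2 : α * q φ ≤ ‖K φ‖ * C := by nlinarith
    rw [div_mul_eq_mul_div, le_div_iff₀ hα]; nlinarith

/-- Consequence: `‖L φ‖ ≤ C_L q(φ)` implies `‖L φ‖ ≤ C_L (C/α) ‖K φ‖`; in particular `ker K ≤ ker L`.
[cite: LionsMagenes1972, Chap. 3 Thm. 1.1 (proof)] -/
theorem ker_repr_le_ker_of_coercive (j : Φ →ₗ[𝕜] F) (q : Φ → ℝ) (hq : ∀ φ, 0 ≤ q φ) {C : ℝ} (hC : 0 ≤ C)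
    (hj : ∀ φ, ‖j φ‖ ≤ C * q φ) (K : Φ →ₗ[𝕜] F) {α : ℝ} (hα : 0 < α)
    (hcoer : ∀ φ, α * q φ ^ 2 ≤ ‖⟪j φ, K φ⟫_𝕜‖) (L : Φ →ₗ[𝕜] 𝕜) {CL : ℝ} (hCL : 0 ≤ CL)
    (hL : ∀ φ, ‖L φ‖ ≤ CL * q φ) :
    (∀ φ, ‖L φ‖ ≤ CL * (C / α) * ‖K φ‖) ∧ LinearMap.ker K ≤ LinearMap.ker L := by
  have hLK : ∀ φ, ‖L φ‖ ≤ CL * (C / α) * ‖K φ‖ := fun φ =>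
    calc ‖L φ‖ ≤ CL * q φ := hL φ
      _ ≤ CL * (C / α * ‖K φ‖) :=
        mul_le_mul_of_nonneg_left (le_norm_repr_of_coercive j q hq hC hj K hα hcoer φ) hCL
      _ = CL * (C / α) * ‖K φ‖ := by ring
  refine ⟨hLK, fun φ hφ => ?_⟩
  rw [LinearMap.mem_ker] at hφ ⊢
  have h := hLK φ
  rw [hφ, norm_zero, mul_zero] at h
  exact norm_le_zero_iff.1 h

variable [CompleteSpace F]

/-- **Lions' projection theorem over `ℝ` or `ℂ`** (Riesz-keyed form).  `F` a Hilbert space, `j, K : Φ → F` linear,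
`q ≥ 0` with `‖j φ‖ ≤ C q(φ)` (`C ≥ 0`), coercivity `α q(φ)² ≤ ‖⟪j φ, K φ⟫‖` (`α > 0`), and `L : Φ → 𝕜` linear with
`‖L φ‖ ≤ C_L q(φ)` (`C_L ≥ 0`).  Then there is `u ∈ F` with `⟪u, K φ⟫ = L φ` for every `φ`, and `‖u‖ ≤ C_L (C/α)`.
[cite: LionsMagenes1972, Chap. 3 Thm. 1.1 and Remark 1.3 (Lions' theorem)] -/
theorem exists_inner_eq_of_coercive (j : Φ →ₗ[𝕜] F) (q : Φ → ℝ) (hq : ∀ φ, 0 ≤ q φ) {C : ℝ} (hC : 0 ≤ C)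
    (hj : ∀ φ, ‖j φ‖ ≤ C * q φ) (K : Φ →ₗ[𝕜] F) {α : ℝ} (hα : 0 < α)
    (hcoer : ∀ φ, α * q φ ^ 2 ≤ ‖⟪j φ, K φ⟫_𝕜‖) (L : Φ →ₗ[𝕜] 𝕜) {CL : ℝ} (hCL : 0 ≤ CL)
    (hL : ∀ φ, ‖L φ‖ ≤ CL * q φ) :
    ∃ u : F, (∀ φ, ⟪u, K φ⟫_𝕜 = L φ) ∧ ‖u‖ ≤ CL * (C / α) := by
  obtain ⟨hLK, hker⟩ := ker_repr_le_ker_of_coercive j q hq hC hj K hα hcoer L hCL hL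
  -- `L` descends to the range of `K` (first isomorphism theorem)
  set ℓ₁ : LinearMap.range K →ₗ[𝕜] 𝕜 :=
    ((LinearMap.ker K).liftQ L hker).comp K.quotKerEquivRange.symm.toLinearMap with hℓ₁
  have hℓ₁K : ∀ φ, ℓ₁ ⟨K φ, LinearMap.mem_range_self K φ⟩ = L φ := by
    intro φ
    simp only [hℓ₁, LinearMap.comp_apply, LinearEquiv.coe_toLinearMap,
      LinearMap.quotKerEquivRange_symm_apply_image, Submodule.mkQ_apply, Submodule.liftQ_apply]
  have hℓ₁_bound : ∀ y : LinearMap.range K, ‖ℓ₁ y‖ ≤ CL * (C / α) * ‖y‖ := by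
    intro y
    obtain ⟨φ, hφ⟩ := LinearMap.mem_range.1 y.2
    have hy : y = ⟨K φ, LinearMap.mem_range_self K φ⟩ := Subtype.ext hφ.symm
    have hn : ‖y‖ = ‖K φ‖ := by rw [hy]; rfl
    rw [hy, hℓ₁K, ← hy, hn]
    exact hLK φ
  set ℓ : StrongDual 𝕜 (LinearMap.range K) := LinearMap.mkContinuous ℓ₁ (CL * (C / α)) hℓ₁_bound with hℓ
  have hℓK : ∀ φ, ℓ ⟨K φ, LinearMap.mem_range_self K φ⟩ = L φ := fun φ => by
    rw [hℓ, LinearMap.mkContinuous_apply]; exact hℓ₁K φ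
  -- Hahn–Banach extension with the same norm, then Riesz
  obtain ⟨g, hg, hgn⟩ := exists_extension_norm_eq (LinearMap.range K) ℓ
  refine ⟨(InnerProductSpace.toDual 𝕜 F).symm g, fun φ => ?_, ?_⟩
  · rw [InnerProductSpace.toDual_symm_apply, hg ⟨K φ, LinearMap.mem_range_self K φ⟩, hℓK]
  · rw [LinearIsometryEquiv.norm_map, hgn]
    exact LinearMap.mkContinuous_norm_le _ (by positivity) _

/-- The same with coercivity of the REAL PART: `α q(φ)² ≤ Re⟪j φ, K φ⟫`.
[cite: LionsMagenes1972, Chap. 3 Thm. 1.1 and Remark 1.3 (Lions' theorem)] -/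
theorem exists_inner_eq_of_re_coercive (j : Φ →ₗ[𝕜] F) (q : Φ → ℝ) (hq : ∀ φ, 0 ≤ q φ) {C : ℝ} (hC : 0 ≤ C)
    (hj : ∀ φ, ‖j φ‖ ≤ C * q φ) (K : Φ →ₗ[𝕜] F) {α : ℝ} (hα : 0 < α)
    (hcoer : ∀ φ, α * q φ ^ 2 ≤ RCLike.re ⟪j φ, K φ⟫_𝕜) (L : Φ →ₗ[𝕜] 𝕜) {CL : ℝ} (hCL : 0 ≤ CL)
    (hL : ∀ φ, ‖L φ‖ ≤ CL * q φ) :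
    ∃ u : F, (∀ φ, ⟪u, K φ⟫_𝕜 = L φ) ∧ ‖u‖ ≤ CL * (C / α) :=
  exists_inner_eq_of_coercive j q hq hC hj K hα (fun φ => (hcoer φ).trans (RCLike.re_le_norm _)) L hCL hL

/-- **Normed test space**: the common case `Φ` a normed space, `q = ‖·‖_Φ`, `j` and `L` bounded.  With coercivity
`α‖φ‖² ≤ Re⟪j φ, K φ⟫` there is `u ∈ F` with `⟪u, K φ⟫ = L φ` for all `φ` and `‖u‖ ≤ ‖L‖ ‖j‖/α`.
[cite: LionsMagenes1972, Chap. 3 Thm. 1.1 and Remark 1.3 (Lions' theorem)] -/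
theorem exists_inner_eq_of_re_coercive_normed {Ψ : Type*} [NormedAddCommGroup Ψ] [NormedSpace 𝕜 Ψ]
    (j : Ψ →L[𝕜] F) (K : Ψ →ₗ[𝕜] F) {α : ℝ} (hα : 0 < α)
    (hcoer : ∀ φ, α * ‖φ‖ ^ 2 ≤ RCLike.re ⟪j φ, K φ⟫_𝕜) (L : Ψ →L[𝕜] 𝕜) :
    ∃ u : F, (∀ φ, ⟪u, K φ⟫_𝕜 = L φ) ∧ ‖u‖ ≤ ‖L‖ * (‖j‖ / α) :=
  exists_inner_eq_of_re_coercive (j : Ψ →ₗ[𝕜] F) (fun φ => ‖φ‖) (fun _ => norm_nonneg _) (norm_nonneg j)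
    (fun φ => j.le_opNorm φ) K hα hcoer (L : Ψ →ₗ[𝕜] 𝕜) (norm_nonneg L) (fun φ => L.le_opNorm φ)

end Literature.Analysis.OperatorTheory
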